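import Summits.CriticalPhenomena.PercolationContinuityZ3.Theorems.Transplant.PlanarSkeletonFrmFromDefs
import Summits.CriticalPhenomena.PercolationContinuityZ3.Theorems.Transplant.SkelFrmFromBChoiceRadii
import Summits.CriticalPhenomena.PercolationContinuityZ3.Theorems.Transplant.SkelFrmBChoiceRadii
import Summits.CriticalPhenomena.PercolationContinuityZ3.Theorems.Transplant.SkelFrmFromBParamsSlotsTA
import Summits.CriticalPhenomena.PercolationContinuityZ3.Theorems.Transplant.SkelFrmBParamsSlotsTA
import Summits.CriticalPhenomena.PercolationContinuityZ3.Theorems.Transplant.SkelFrmFromBParamsKitS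
import Summits.CriticalPhenomena.PercolationContinuityZ3.Theorems.Transplant.SkelFrmBParamsKitS
import HarnessLib
import Summits.CriticalPhenomena.PercolationContinuityZ3.Theorems.Transplant.SkelFrmBChoiceRows
/-!
# U-WAVE PORT (RULING D-U, lead g21 2026-08-26; WAVE-U-MANIFEST v3.0 row «SkelFrmBChoiceRows» ↦ «SkelFrmFromBChoiceRows») of the tree module
# `Transplant/SkelFrmBChoiceRows` onto the carrier `PlanarSkeletonFrmFrom` (frames only, cylinders connected from width `ℓ₀` on)

ORIGINAL TITLE: N2 (frames-only node `SamePDropOfSkeletonFrm₁`, OPEN), WAVE 1 VALUE ROWS: the short-region radius against the cells and the cube at the BOX SLOT OF RECORD `gT` —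

builds on p205010 (kernel theorem, internal audit signed; external expert review pending) — nothing in this file uses p205010; NOTHING is claimed about the
OPEN node U `SamePDropOfSkeletonFrmFrom₁` (nor U_s / the end state).  Lane `prim-bschramm`, seat `prim-hp-8 gen 53 (U-wave port pen, family P-hp8; tool of record = p3-g26 port_u.py)`; helper file
(`--supports stmt-CriticalPhenomena-4575 --as helper`).  PORT RULES r1–r4 of RULING D-U: declaration order and proof texts are those of the original,
byte-identical except (i) the carrier token `PlanarSkeletonFrm ↦ PlanarSkeletonFrmFrom` (binders, `namespace`/`end` lines, qualified names of twinned
declarations), (ii) carrier-FREE declarations of the original (φ-level `Skelφ…` blocks and namespace-only arithmetic residents) are NOT re-declared —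
this file imports the original and `export`s the twin-free residents (POLICY T / treatment (m1)); residents whose statement mentions a twinned
constant are copied, (iii) every carrier-binding declaration keeps its explicit binder `(Φ : PlanarSkeletonFrmFrom G)` in its own signature (r2).  Docstrings and citations are the original's.  Manifest row idx 99 (level 13; flags verbatim); filed by the hp-8 lineage under RULING M-11 (family P-hp8).
-/

noncomputable section

open scoped Classical

namespace Summit.CriticalPhenomena.PercolationContinuityZ3.Theorems.Transplant

namespace PlanarSkeletonFrmFrom

namespace NegB

open Literature.Probability.Percolation Literature.Probability.LatticeModels SimpleGraph
open SkelConc (Consts)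
open Neg

section AtT

variable (κ : Consts) {V : Type} [DecidableEq V] [Countable V] {G : SimpleGraph V} [G.LocallyFinite] (Φ : PlanarSkeletonFrmFrom G) (t : V)
  (p : unitInterval) (D : Skelφ.StepI.DataNS V) (mk : ℕ) (gx : Neg.FSlot) (f : ℕ) (c : Fin 2 → ℕ)

/-- **`RA′ ≤ r_i`** at `g := gT` (`K ≥ 40`, `Kq ≥ 1`, `K·Kq·(6RA′+11) ≤ r₀`, `K·Kq·(14RA′+27) ≤ r₁`). [folklore] -/
theorem RA'_le_r_TA (κ : Consts) {V : Type} [DecidableEq V] [Countable V] {G : SimpleGraph V} [G.LocallyFinite] (Φ : PlanarSkeletonFrmFrom G) (t : V) (p : unitInterval) (D : Skelφ.StepI.DataNS V) (mk : ℕ) (gx : Neg.FSlot) (f : ℕ) (hN : EqNumL κ Φ t p D (KS.gT mk gx κ Φ t p D) f) (hκ : (hL κ Φ t p D (KS.gT mk gx κ Φ t p D) f).natAbs ≤ 10 * nL κ Φ t p D (KS.gT mk gx κ Φ t p D) f) :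
    ∀ i, (KS.RA' κ Φ t p D mk : ℤ) ≤ ((fcellsA κ Φ t p D (KS.gT mk gx κ Φ t p D) f).r i : ℤ) := by
  obtain ⟨h0, h1⟩ := KS.r_geTA κ Φ t p D mk gx f hN hκ
  have hK : (40 : ℤ) ≤ Neg.K κ := by exact_mod_cast (Neg.forty_le_K κ).1
  have hR : (0 : ℤ) ≤ (KS.RA' κ Φ t p D mk : ℤ) := by positivity
  have hq : (1 : ℤ) ≤ Neg.Kq κ := by exact_mod_cast Neg.one_le_Kq κ
  have h6 : (1 : ℤ) * (6 * (KS.RA' κ Φ t p D mk : ℤ) + 11) ≤ (Neg.Kq κ : ℤ) * (6 * (KS.RA' κ Φ t p D mk : ℤ) + 11) := mul_le_mul_of_nonneg_right hq (by linarith)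
  have h14 : (1 : ℤ) * (14 * (KS.RA' κ Φ t p D mk : ℤ) + 27) ≤ (Neg.Kq κ : ℤ) * (14 * (KS.RA' κ Φ t p D mk : ℤ) + 27) := mul_le_mul_of_nonneg_right hq (by linarith)
  have h0' := mul_le_mul_of_nonneg_left h6 (by linarith : (0 : ℤ) ≤ Neg.K κ)
  have h1' := mul_le_mul_of_nonneg_left h14 (by linarith : (0 : ℤ) ≤ Neg.K κ)
  intro i
  obtain rfl | rfl : i = 0 ∨ i = 1 := by fin_cases i <;> simp
  · nlinarith
  · nlinarith

/-- **`hRs5`: `Rs + 1 ≤ 5·r_i`** (indeed `Rs + 3 ≤ r_i`) at `g := gT`, for the staggered cells `fcellsS … c` (any creep value). [folklore] -/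
theorem hRs5_TA (κ : Consts) {V : Type} [DecidableEq V] [Countable V] {G : SimpleGraph V} [G.LocallyFinite] (Φ : PlanarSkeletonFrmFrom G) (t : V) (p : unitInterval) (D : Skelφ.StepI.DataNS V) (mk : ℕ) (gx : Neg.FSlot) (f : ℕ) (c : Fin 2 → ℕ) (hN : EqNumL κ Φ t p D (KS.gT mk gx κ Φ t p D) f) (hκ : (hL κ Φ t p D (KS.gT mk gx κ Φ t p D) f).natAbs ≤ 10 * nL κ Φ t p D (KS.gT mk gx κ Φ t p D) f) :
    ∀ i, KS.Rs t D mk + 1 ≤ 5 * (fcellsS κ Φ t p D (KS.gT mk gx κ Φ t p D) f c).r i := by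
  intro i
  have h1 := RA'_le_r_TA κ Φ t p D mk gx f hN hκ i
  have h2 := (KS.T₀a_lt_RA' κ Φ t p D mk).2.1
  rw [fcellsS_r]
  have h3 : (KS.Rs t D mk : ℤ) + 2 < ((fcellsA κ Φ t p D (KS.gT mk gx κ Φ t p D) f).r i : ℤ) := lt_of_lt_of_le (by exact_mod_cast h2) h1
  omega

end AtT

section AtSUS

variable (κ : Consts) {V : Type} [DecidableEq V] [Countable V] {G : SimpleGraph V} [G.LocallyFinite] (Φ : PlanarSkeletonFrmFrom G) (t : V)
  (p : unitInterval) (D : Skelφ.StepI.DataNS V) (g f : ℕ) (c : Fin 2 → ℕ) (mk : ℕ) (ex mx : GSlot) (q : unitInterval)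

/-- **`hRsQ` as a floor on `ex`**: `Rs + 2 ≤ ex → Rs + 2 ≤ rQ 0 0` at the schedule of record. [folklore] -/
theorem hRsQ_of_le_ex (κ : Consts) {V : Type} [DecidableEq V] [Countable V] {G : SimpleGraph V} [G.LocallyFinite] (Φ : PlanarSkeletonFrmFrom G) (t : V) (p : unitInterval) (D : Skelφ.StepI.DataNS V) (g : ℕ) (f : ℕ) (c : Fin 2 → ℕ) (mk : ℕ) (ex : GSlot) (mx : GSlot) (q : unitInterval) (h : KS.Rs t D mk + 2 ≤ ex κ Φ t p D g f) :
    KS.Rs t D mk + 2 ≤ (schedOfS κ Φ t p D g f c (SUS ex mx κ Φ t p D g f q)).rQ 0 0 :=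
  le_rQ_of_le_ex κ Φ t p D g f c ex mx q h 0 0

/-- **`hRsR` as a floor on `ex`**: `Rs ≤ ex → Rs ≤ rQ a x` (the corridor window radius `R := rQ α x`). [folklore] -/
theorem hRsR_of_le_ex (κ : Consts) {V : Type} [DecidableEq V] [Countable V] {G : SimpleGraph V} [G.LocallyFinite] (Φ : PlanarSkeletonFrmFrom G) (t : V) (p : unitInterval) (D : Skelφ.StepI.DataNS V) (g : ℕ) (f : ℕ) (c : Fin 2 → ℕ) (mk : ℕ) (ex : GSlot) (mx : GSlot) (q : unitInterval) (h : KS.Rs t D mk ≤ ex κ Φ t p D g f) (a : ℕ) (x : Site 2) :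
    KS.Rs t D mk ≤ (schedOfS κ Φ t p D g f c (SUS ex mx κ Φ t p D g f q)).rQ a x :=
  le_rQ_of_le_ex κ Φ t p D g f c ex mx q h a x

end AtSUS

end NegB

end PlanarSkeletonFrmFrom

end Summit.CriticalPhenomena.PercolationContinuityZ3.Theorems.Transplant

end
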